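import Literature.MathematicalPhysics.QuantumFieldTheory.Balaban1983to89.T4ExpWindowSmallField
import HarnessLib

/-!
# Line «covariant_discharge» on crux `HistoryTailL` (stmt-QuantumFields-19936) — step «sign of `n̂` against the event and an
# `S²`-net over directions»: the DIRECTION NET and the UNION BOUND in kernel form, with the `SU(2)` dictionary
# `|vector part|² = dist1²(1 − dist1²/4)`

Cell `ym3-torus` (YM ladder rung R3 = continuum SU(2) Yang–Mills on the three-torus — a RUNG, NOT the Clay problem: not d = 4, not
infinite volume, not a mass gap), width seat `ym-ust-19936-w3` gen 8, second helper brick (E-2) for the hardest stub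
`stub_unboundedDepth` of the registered line «covariant_discharge» (`Cruxes/HistoryTailL/Lines/covariant_discharge.lean`).  The line's
card reduces the plaquette tail `{θ ≤ dist1(Ū^j(∂p))}` to ONE-DIRECTIONAL tails `{θ' ≤ ⟨n̂, Y⟩}` of the `su(2) ≅ ℝ³`-valued statistic
`Y` (the vector part of the holonomy) over a finite net of directions `n̂ ∈ S²`, each of which is then bounded by the covariant sweep in the
direction `n̂` (the engine `CovariantDischargeHaarSweepReweighting`, ✓).  THIS FILE is that reduction, route-independent:

* §1 (any real inner-product space) `inner_eq_one_sub_of_norm_eq_one` (`⟨n,u⟩ = 1 − ‖u−n‖²/2` on unit vectors); in finite dimension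
  `exists_finset_net_sphere` (a finite `δ`-net of the unit sphere — compactness) and ★`exists_finset_sphere_inner_ge`: for every `δ > 0`
  a finite NONEMPTY set `s` of unit vectors with `∀ v, ∃ n ∈ s, (1 − δ²/2)‖v‖ ≤ ⟨n, v⟩`.
* §2 (any finite measure) the UNION BOUND ★`measureReal_norm_ge_le_sum`:
  `μ(A ∩ {θ ≤ ‖Y‖}) ≤ Σ_{n ∈ s} μ(A ∩ {cθ ≤ ⟨n, Y⟩})` for any direction set with `∀ v, ∃ n ∈ s, c‖v‖ ≤ ⟨n,v⟩`, `c ≥ 0`, and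
  `… ≤ #s · B` under a uniform bound `B` of the one-directional tails (`measureReal_norm_ge_le_card_mul`).
* §3 the `SU(2)` DICTIONARY between the cell's small-field metric `dist1 U = ‖U − 1‖` (operator norm) and the vector part
  `imVec (su2Quat U) ∈ ℝ³` of the unit quaternion of `U`: `dist1_sq_eq_two_sub_two_re` (`dist1² = 2 − 2re`), ★`norm_imVec_sq_eq`
  (`‖imVec‖² = dist1²·(1 − dist1²/4)`), `norm_imVec_le_dist1`, and on a window `θ ≤ dist1 U ≤ θ₂ ≤ 2` the lower bound
  ★`mul_sqrt_le_norm_imVec` (`θ·√(1 − θ₂²/4) ≤ ‖imVec‖`); whence §4 the PLAQUETTE-EVENT REDUCTION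
  ★`measureReal_dist1_window_le_sum`: `μ(A ∩ {dist1 H ≤ θ₂} ∩ {θ ≤ dist1 H}) ≤ Σ_{n ∈ s} μ(A ∩ {dist1 H ≤ θ₂} ∩ {c·θ√(1−θ₂²/4) ≤ ⟨n, imVec(H)⟩})`
  for any `SU(2)`-valued measurable-or-not statistic `H` (in the line: `H = Ū^j(∂p)`, `A` = the history window, `θ₂ = θ(b₂)`).

WHAT THIS IS NOT.  Finite-dimensional geometry and a union bound only: nothing here touches the Gibbs measure, the sweep, the action gap
or the defect budget; nothing of `stub_unboundedDepth`, `DeepWindowTailL`, `HistoryTailL`, the rung R3, d = 4, a continuum limit or a mass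
gap is proved.  YM₃ on T³ is rung R3 of the programme, NOT the Clay problem.  All statements are folklore.
-/

noncomputable section

open MeasureTheory Set Metric
open scoped RealInnerProductSpace Quaternion

namespace Summit.QuantumFields.YangMills.Theorems.CovariantDischargeDirectionNet

/-! ## §1 Finite nets of directions -/

section Net

variable {E : Type*} [NormedAddCommGroup E] [InnerProductSpace ℝ E]

/-- On unit vectors the inner product is read off the chord: `⟨n, u⟩ = 1 − ‖u − n‖²/2`. [folklore] -/
theorem inner_eq_one_sub_of_norm_eq_one {u n : E} (hu : ‖u‖ = 1) (hn : ‖n‖ = 1) :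
    ⟪n, u⟫ = 1 - ‖u - n‖ ^ 2 / 2 := by
  have h := norm_sub_sq_real u n
  rw [hu, hn, real_inner_comm] at h
  linarith

variable [FiniteDimensional ℝ E]

/-- **A FINITE `δ`-NET OF THE UNIT SPHERE** of a finite-dimensional real inner-product space (compactness of the sphere). [folklore] -/
theorem exists_finset_net_sphere {δ : ℝ} (hδ : 0 < δ) :
    ∃ s : Finset E, (∀ n ∈ s, ‖n‖ = 1) ∧ ∀ u : E, ‖u‖ = 1 → ∃ n ∈ s, ‖u - n‖ < δ := by
  obtain ⟨t, hts, htf, hcov⟩ := (isCompact_sphere (0 : E) 1).finite_cover_balls hδ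
  refine ⟨htf.toFinset, fun n hn => mem_sphere_zero_iff_norm.mp (hts (htf.mem_toFinset.mp hn)), fun u hu => ?_⟩
  obtain ⟨n, hn, hun⟩ := mem_iUnion₂.mp (hcov (mem_sphere_zero_iff_norm.mpr hu))
  exact ⟨n, htf.mem_toFinset.mpr hn, by rwa [mem_ball, dist_eq_norm] at hun⟩

/-- **THE DIRECTION NET**: for every `δ > 0` there is a finite nonempty set `s` of unit vectors such that EVERY vector `v` has a
direction `n ∈ s` with `(1 − δ²/2)·‖v‖ ≤ ⟨n, v⟩` (take `n` within `δ` of `v/‖v‖`). [folklore] -/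
theorem exists_finset_sphere_inner_ge [Nontrivial E] {δ : ℝ} (hδ : 0 < δ) :
    ∃ s : Finset E, s.Nonempty ∧ (∀ n ∈ s, ‖n‖ = 1) ∧ ∀ v : E, ∃ n ∈ s, (1 - δ ^ 2 / 2) * ‖v‖ ≤ ⟪n, v⟫ := by
  obtain ⟨s, hs1, hnet⟩ := exists_finset_net_sphere (E := E) hδ
  obtain ⟨u₀, hu₀⟩ := (NormedSpace.sphere_nonempty (x := (0 : E)) (r := 1)).mpr zero_le_one
  obtain ⟨n₀, hn₀, -⟩ := hnet u₀ (mem_sphere_zero_iff_norm.mp hu₀)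
  refine ⟨s, ⟨n₀, hn₀⟩, hs1, fun v => ?_⟩
  by_cases hv : v = 0
  · exact ⟨n₀, hn₀, by simp [hv]⟩
  have hv' : 0 < ‖v‖ := norm_pos_iff.mpr hv
  have hu : ‖‖v‖⁻¹ • v‖ = 1 := by rw [norm_smul, norm_inv, norm_norm, inv_mul_cancel₀ hv'.ne']
  obtain ⟨n, hn, hun⟩ := hnet _ hu
  refine ⟨n, hn, ?_⟩
  have h1 := inner_eq_one_sub_of_norm_eq_one hu (hs1 n hn)
  rw [real_inner_smul_right] at h1
  have h2 : ‖‖v‖⁻¹ • v - n‖ ^ 2 ≤ δ ^ 2 := pow_le_pow_left₀ (norm_nonneg _) hun.le 2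
  have h3 : ⟪n, v⟫ = ‖v‖ * (1 - ‖‖v‖⁻¹ • v - n‖ ^ 2 / 2) := by
    rw [← h1, ← mul_assoc, mul_inv_cancel₀ hv'.ne', one_mul]
  rw [h3]
  nlinarith [mul_nonneg hv'.le (sub_nonneg.mpr h2)]

end Net

/-! ## §2 The union bound over a direction net -/

section UnionBound

variable {X : Type*} [MeasurableSpace X] {μ : Measure X} {E : Type*} [NormedAddCommGroup E] [InnerProductSpace ℝ E]

omit [MeasurableSpace X] in
/-- Pointwise: `A ∩ {θ ≤ ‖Y‖} ⊆ ⋃_{n ∈ s} A ∩ {cθ ≤ ⟨n, Y⟩}` for a direction set with `∀ v, ∃ n ∈ s, c‖v‖ ≤ ⟨n,v⟩`, `c ≥ 0`. [folklore] -/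
theorem setOf_norm_ge_subset_biUnion (s : Finset E) {c : ℝ} (hc : 0 ≤ c)
    (hnet : ∀ v : E, ∃ n ∈ s, c * ‖v‖ ≤ ⟪n, v⟫) (A : Set X) (Y : X → E) (θ : ℝ) :
    {x | x ∈ A ∧ θ ≤ ‖Y x‖} ⊆ ⋃ n ∈ s, {x | x ∈ A ∧ c * θ ≤ ⟪n, Y x⟫} := by
  intro x hx
  obtain ⟨n, hn, hnx⟩ := hnet (Y x)
  exact mem_iUnion₂.mpr ⟨n, hn, hx.1, (mul_le_mul_of_nonneg_left hx.2 hc).trans hnx⟩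

variable [IsFiniteMeasure μ]

/-- **THE UNION BOUND OVER DIRECTIONS**: `μ(A ∩ {θ ≤ ‖Y‖}) ≤ Σ_{n ∈ s} μ(A ∩ {cθ ≤ ⟨n, Y⟩})` — the norm tail of a vector statistic is
controlled by finitely many one-directional tails. No measurability is needed (outer measure). [folklore] -/
theorem measureReal_norm_ge_le_sum (s : Finset E) {c : ℝ} (hc : 0 ≤ c)
    (hnet : ∀ v : E, ∃ n ∈ s, c * ‖v‖ ≤ ⟪n, v⟫) (A : Set X) (Y : X → E) (θ : ℝ) :
    μ.real {x | x ∈ A ∧ θ ≤ ‖Y x‖} ≤ ∑ n ∈ s, μ.real {x | x ∈ A ∧ c * θ ≤ ⟪n, Y x⟫} :=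
  (measureReal_mono (setOf_norm_ge_subset_biUnion s hc hnet A Y θ) (measure_ne_top _ _)).trans
    (measureReal_biUnion_finset_le s _)

/-- The union bound with a uniform bound `B` on the one-directional tails: `μ(A ∩ {θ ≤ ‖Y‖}) ≤ #s · B`. [folklore] -/
theorem measureReal_norm_ge_le_card_mul (s : Finset E) {c : ℝ} (hc : 0 ≤ c)
    (hnet : ∀ v : E, ∃ n ∈ s, c * ‖v‖ ≤ ⟪n, v⟫) (A : Set X) (Y : X → E) (θ : ℝ) {B : ℝ}
    (hB : ∀ n ∈ s, μ.real {x | x ∈ A ∧ c * θ ≤ ⟪n, Y x⟫} ≤ B) :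
    μ.real {x | x ∈ A ∧ θ ≤ ‖Y x‖} ≤ s.card * B :=
  (measureReal_norm_ge_le_sum s hc hnet A Y θ).trans ((Finset.sum_le_card_nsmul s _ B hB).trans_eq (nsmul_eq_mul _ _))

/-- **NET FORM** (finite dimension, `0 < δ`, `δ² ≤ 2`): there is a finite nonempty set `s` of unit directions, depending on `δ` and the
space only, with `μ(A ∩ {θ ≤ ‖Y‖}) ≤ Σ_{n ∈ s} μ(A ∩ {(1 − δ²/2)θ ≤ ⟨n, Y⟩})` for every finite measure `μ`, event `A`, statistic `Y`
and level `θ`. [folklore] -/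
theorem exists_net_measureReal_norm_ge_le_sum [FiniteDimensional ℝ E] [Nontrivial E] {δ : ℝ} (hδ : 0 < δ) (hδ2 : δ ^ 2 ≤ 2) :
    ∃ s : Finset E, s.Nonempty ∧ (∀ n ∈ s, ‖n‖ = 1) ∧ ∀ (ν : Measure X) [IsFiniteMeasure ν] (A : Set X) (Y : X → E) (θ : ℝ),
      ν.real {x | x ∈ A ∧ θ ≤ ‖Y x‖} ≤ ∑ n ∈ s, ν.real {x | x ∈ A ∧ (1 - δ ^ 2 / 2) * θ ≤ ⟪n, Y x⟫} := by
  obtain ⟨s, hne, hs1, hnet⟩ := exists_finset_sphere_inner_ge (E := E) hδ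
  exact ⟨s, hne, hs1, fun ν _ A Y θ => measureReal_norm_ge_le_sum s (by linarith) hnet A Y θ⟩

end UnionBound

/-! ## §3 The `SU(2)` dictionary: `dist1` versus the vector part of the unit quaternion -/

section SU2

open Literature.MathematicalPhysics.QuantumLattice (su2Quat norm_su2Quat)
open Literature.MathematicalPhysics.QuantumFieldTheory.Balaban1983to89
open Literature.MathematicalPhysics.QuantumFieldTheory.Balaban1983to89.T4CubeChartGnomonic (SU2)
open Literature.MathematicalPhysics.QuantumFieldTheory.Balaban1983to89.T4ExpWindowSmallField
  (imVec norm_imVec_sq_of_norm_eq_one norm_sub_one_sq dist1_eq_norm_su2Quat_sub_one)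

/-- `dist1 U² = 2 − 2·re(su2Quat U)` (`dist1 = ‖U − 1‖`, chord formula on the unit quaternions). [folklore] -/
theorem dist1_sq_eq_two_sub_two_re (U : SU2) : dist1 U ^ 2 = 2 - 2 * (su2Quat U).re := by
  rw [dist1_eq_norm_su2Quat_sub_one, norm_sub_one_sq (norm_su2Quat U)]

/-- **THE VECTOR PART AGAINST `dist1`**: `‖imVec (su2Quat U)‖² = dist1 U²·(1 − dist1 U²/4)` (with `dist1 = 2 sin(φ/2)`,
`‖imVec‖ = sin φ`). [folklore] -/
theorem norm_imVec_sq_eq (U : SU2) : ‖imVec (su2Quat U)‖ ^ 2 = dist1 U ^ 2 * (1 - dist1 U ^ 2 / 4) := by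
  rw [norm_imVec_sq_of_norm_eq_one (norm_su2Quat U)]
  have hre : (su2Quat U).re = 1 - dist1 U ^ 2 / 2 := by linarith [dist1_sq_eq_two_sub_two_re U]
  rw [hre]
  ring

/-- `dist1 U ≤ 2` on `SU(2)` (`‖q − 1‖ ≤ ‖q‖ + 1`). [folklore] -/
theorem dist1_le_two (U : SU2) : dist1 U ≤ 2 := by
  rw [dist1_eq_norm_su2Quat_sub_one]
  have h := norm_sub_le (su2Quat U) 1
  rw [norm_su2Quat U, norm_one] at h
  linarith

/-- The vector part is at most `dist1`: `‖imVec (su2Quat U)‖ ≤ dist1 U`. [folklore] -/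
theorem norm_imVec_le_dist1 (U : SU2) : ‖imVec (su2Quat U)‖ ≤ dist1 U := by
  have h0 : 0 ≤ dist1 U := GaugeGroup.dist1_nonneg U
  have hsq : ‖imVec (su2Quat U)‖ ^ 2 ≤ dist1 U ^ 2 := by
    nlinarith [norm_imVec_sq_eq U, sq_nonneg (dist1 U), sq_nonneg (dist1 U ^ 2)]
  exact (pow_le_pow_iff_left₀ (norm_nonneg _) h0 two_ne_zero).mp hsq

/-- **LOWER BOUND ON A WINDOW**: `0 ≤ θ ≤ dist1 U ≤ θ₂ ≤ 2` gives `θ·√(1 − θ₂²/4) ≤ ‖imVec (su2Quat U)‖` — on the first-exit window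
the `dist1`-tail is a tail of the vector part, up to the factor `√(1 − θ₂²/4)` (close to `1` for small thresholds). [folklore] -/
theorem mul_sqrt_le_norm_imVec {U : SU2} {θ θ₂ : ℝ} (hθ : 0 ≤ θ) (h₁ : θ ≤ dist1 U) (h₂ : dist1 U ≤ θ₂) (hθ₂ : θ₂ ≤ 2) :
    θ * Real.sqrt (1 - θ₂ ^ 2 / 4) ≤ ‖imVec (su2Quat U)‖ := by
  have hd0 : 0 ≤ dist1 U := GaugeGroup.dist1_nonneg U
  have hA : 0 ≤ 1 - θ₂ ^ 2 / 4 := by nlinarith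
  have hB : 1 - θ₂ ^ 2 / 4 ≤ 1 - dist1 U ^ 2 / 4 := by nlinarith
  have hsq : (θ * Real.sqrt (1 - θ₂ ^ 2 / 4)) ^ 2 ≤ ‖imVec (su2Quat U)‖ ^ 2 := by
    rw [mul_pow, Real.sq_sqrt hA, norm_imVec_sq_eq]
    exact mul_le_mul (pow_le_pow_left₀ hθ h₁ 2) hB hA (sq_nonneg _)
  exact (pow_le_pow_iff_left₀ (mul_nonneg hθ (Real.sqrt_nonneg _)) (norm_nonneg _) two_ne_zero).mp hsq

end SU2

/-! ## §4 The plaquette-event reduction: `dist1`-window tail ⇒ finitely many one-directional tails of the vector part -/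

section Reduction

open Literature.MathematicalPhysics.QuantumLattice (su2Quat)
open Literature.MathematicalPhysics.QuantumFieldTheory.Balaban1983to89
open Literature.MathematicalPhysics.QuantumFieldTheory.Balaban1983to89.T4CubeChartGnomonic (SU2)
open Literature.MathematicalPhysics.QuantumFieldTheory.Balaban1983to89.T4ExpWindowSmallField (imVec)

variable {X : Type*} [MeasurableSpace X] {μ : Measure X} [IsFiniteMeasure μ]

omit [MeasurableSpace X] in
/-- Pointwise: `A ∩ {dist1 H ≤ θ₂} ∩ {θ ≤ dist1 H} ⊆ ⋃_{n ∈ s} A ∩ {dist1 H ≤ θ₂} ∩ {c·θ√(1−θ₂²/4) ≤ ⟨n, imVec(su2Quat H)⟩}`. [folklore] -/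
theorem setOf_dist1_window_subset_biUnion (s : Finset (EuclideanSpace ℝ (Fin 3))) {c : ℝ} (hc : 0 ≤ c)
    (hnet : ∀ v : EuclideanSpace ℝ (Fin 3), ∃ n ∈ s, c * ‖v‖ ≤ ⟪n, v⟫) (A : Set X) (H : X → SU2)
    {θ θ₂ : ℝ} (hθ : 0 ≤ θ) (hθ₂ : θ₂ ≤ 2) :
    {x | x ∈ A ∧ dist1 (H x) ≤ θ₂ ∧ θ ≤ dist1 (H x)} ⊆
      ⋃ n ∈ s, {x | (x ∈ A ∧ dist1 (H x) ≤ θ₂) ∧ c * (θ * Real.sqrt (1 - θ₂ ^ 2 / 4)) ≤ ⟪n, imVec (su2Quat (H x))⟫} := by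
  intro x hx
  have hv := mul_sqrt_le_norm_imVec hθ hx.2.2 hx.2.1 hθ₂
  have hsub := setOf_norm_ge_subset_biUnion s hc hnet {x | x ∈ A ∧ dist1 (H x) ≤ θ₂} (fun x => imVec (su2Quat (H x)))
    (θ * Real.sqrt (1 - θ₂ ^ 2 / 4))
  exact hsub ⟨⟨hx.1, hx.2.1⟩, hv⟩

/-- **THE PLAQUETTE-EVENT REDUCTION**: for a direction set `s` (`∀ v, ∃ n ∈ s, c‖v‖ ≤ ⟨n,v⟩`, `c ≥ 0`), any event `A`, any `SU(2)`-valued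
statistic `H` and thresholds `0 ≤ θ`, `θ₂ ≤ 2`:
`μ(A ∩ {dist1 H ≤ θ₂} ∩ {θ ≤ dist1 H}) ≤ Σ_{n ∈ s} μ(A ∩ {dist1 H ≤ θ₂} ∩ {c·θ·√(1−θ₂²/4) ≤ ⟨n, imVec(su2Quat H)⟩})`.
In the line: `μ = gibbsK`, `H = Ū^j(∂p)`, `A` = the history window, `θ = θ(b₀)(K−j)`, `θ₂ = θ(b₂)(K−j)`. [folklore] -/
theorem measureReal_dist1_window_le_sum (s : Finset (EuclideanSpace ℝ (Fin 3))) {c : ℝ} (hc : 0 ≤ c)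
    (hnet : ∀ v : EuclideanSpace ℝ (Fin 3), ∃ n ∈ s, c * ‖v‖ ≤ ⟪n, v⟫) (A : Set X) (H : X → SU2)
    {θ θ₂ : ℝ} (hθ : 0 ≤ θ) (hθ₂ : θ₂ ≤ 2) :
    μ.real {x | x ∈ A ∧ dist1 (H x) ≤ θ₂ ∧ θ ≤ dist1 (H x)} ≤
      ∑ n ∈ s, μ.real {x | (x ∈ A ∧ dist1 (H x) ≤ θ₂) ∧ c * (θ * Real.sqrt (1 - θ₂ ^ 2 / 4)) ≤ ⟪n, imVec (su2Quat (H x))⟫} :=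
  (measureReal_mono (setOf_dist1_window_subset_biUnion s hc hnet A H hθ hθ₂) (measure_ne_top _ _)).trans
    (measureReal_biUnion_finset_le s _)

/-- **NET FORM OF THE REDUCTION** (`0 < δ`, `δ² ≤ 2`): a finite nonempty set `s ⊂ S² ⊂ ℝ³` depending on `δ` only, with
`μ(A ∩ {dist1 H ≤ θ₂} ∩ {θ ≤ dist1 H}) ≤ Σ_{n ∈ s} μ(A ∩ {dist1 H ≤ θ₂} ∩ {(1−δ²/2)·θ·√(1−θ₂²/4) ≤ ⟨n, imVec(su2Quat H)⟩})` for every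
finite measure, event, `SU(2)`-statistic and thresholds `0 ≤ θ`, `θ₂ ≤ 2`. [folklore] -/
theorem exists_net_measureReal_dist1_window_le_sum {δ : ℝ} (hδ : 0 < δ) (hδ2 : δ ^ 2 ≤ 2) :
    ∃ s : Finset (EuclideanSpace ℝ (Fin 3)), s.Nonempty ∧ (∀ n ∈ s, ‖n‖ = 1) ∧
      ∀ (ν : Measure X) [IsFiniteMeasure ν] (A : Set X) (H : X → SU2) (θ θ₂ : ℝ), 0 ≤ θ → θ₂ ≤ 2 →
        ν.real {x | x ∈ A ∧ dist1 (H x) ≤ θ₂ ∧ θ ≤ dist1 (H x)} ≤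
          ∑ n ∈ s, ν.real {x | (x ∈ A ∧ dist1 (H x) ≤ θ₂) ∧
            (1 - δ ^ 2 / 2) * (θ * Real.sqrt (1 - θ₂ ^ 2 / 4)) ≤ ⟪n, imVec (su2Quat (H x))⟫} := by
  obtain ⟨s, hne, hs1, hnet⟩ := exists_finset_sphere_inner_ge (E := EuclideanSpace ℝ (Fin 3)) hδ
  exact ⟨s, hne, hs1, fun ν _ A H θ θ₂ hθ hθ₂ => measureReal_dist1_window_le_sum s (by linarith) hnet A H hθ hθ₂⟩

end Reduction

end Summit.QuantumFields.YangMills.Theorems.CovariantDischargeDirectionNet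

end
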